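import Summits.QuantumFields.YangMills.Theorems.UnitScaleTiltProp7CornerFrameLegsPropagation
import HarnessLib

/-!
# `UnitScaleTiltProp7RLegsCovScalar` — LANE II (R-LEGS), (K2-S): THE SCALAR KNIT OF THE CURVED CORNER-FRAME LEGS —
# two coupled one-step recursions (`E` legs, `M` legs-mass) fed by the two per-level rows (`G` gradient energy, `N` mass of the single-bar linear tower) and the geometric
# curvature letter `a_l ≤ 4e·(Lˡ∕Lᵏ)²` give `E_k ≤ Cr·Lᵏ·GA + Cr′·e·L⁻ᵏ·SA` (crux `MinimiserStabilityRegPr`, stmt-QuantumFields-19200, EX lane, hN06 LANE II supplier (R-LEGS);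
# `--supports stmt-QuantumFields-19200 --as helper`, count-neutral)

Cell `ym3-torus` (HUMAN RULING D-0037: YM₃ on T³ is ladder rung R3 — NOT d = 4, NOT infinite volume, NOT a mass gap, NOT the Clay problem), width seat `ym-ust-20520-w4` (g12), pen of the
curved row `rlegs`.  THEOREMS ONLY (0 `def`, 0 `sorry`), PURE REAL ARITHMETIC; nothing here claims (R-LEGS-cov), (QB), (QH1), (REC), `hN06`, EX or the crux.

THE POINT.  At `d = 3` the member's letters obey, for `l < k = K − n` (✓`Prop7CornerFrameLegsStepCell.legs_step_cell_le` summed over the coarse direction, ✓`…MassStep.mass_step_cell_le`,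
✓`…Curvature` with the level plaquette letter `a_l`):
`E_{l+1} ≤ 4L⁻¹·E_l + pM·a_l²·M_l + aG·G_l + pN·a_l²·N_l`, `M_{l+1} ≤ 2L⁻³·M_l + bN·N_l`, `E_0 ≤ 0`, `M_0 ≤ 0`, `0 ≤ a_l ≤ 4e·(Lˡ·(Lᵏ)⁻¹)²`,
and ★routeR's two rows `G_l ≤ CG·Lˡ·GA + CG′·e²·L^{3l}·(Lᵏ)⁻⁴·SA`, `N_l ≤ CN·L⁻ˡ·SA + CN′·Lˡ·GA + CN″·e²·L^{3l}·(Lᵏ)⁻⁴·SA` (`GA` = the covariant gradient energy of `A`, `SA = Σ‖A‖²`).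
Then (`L ≥ 3`, `0 < e ≤ 1`): the mass recursion has the two source rates `L⁻¹, L` above `2L⁻³`, the legs recursion the two rates `L, L³` above `4L⁻¹` (the `L⁵, L⁷` products are dominated
termwise by `(Lˡ)⁴(Lᵏ)⁻⁴ ≤ 1`, `L^{3l}(Lᵏ)⁻⁴ ≤ L⁻ˡ`), and ✓`Prop7CornerFrameLegsPropagation`'s invariant gives `E_k ≤ Cr·Lᵏ·GA + Cr′·e·(Lᵏ)⁻¹·SA` with `Cr, Cr′` depending on `L` and the
row constants only — the constants of (R-LEGS-cov) (✓p707999 `rlegs_of_covGradLegs`'s hypothesis `hCov`).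

* §1 `rec_two_rates_le_upto` — the two-rate invariant with hypotheses only below `k`.
* §2 ★★★ `scalar_legs_knit` — the title.
HONEST SCOPE.  Real arithmetic; the member's identification of the letters is the next file.  Rung R3; nothing of the crux ∕ the gap is claimed.

References: T. Bałaban, CMP 98 (1985) 17–51 [Balaban1985Averaging] ((97) p.32, (110)–(112) p.34, (160)–(163) p.42).
-/

set_option autoImplicit false

noncomputable section

open scoped BigOperators

namespace Summit.QuantumFields.YangMills.Theorems.Prop7RLegsCovScalar

open Summit.QuantumFields.YangMills.Theorems.Prop7CornerFrameLegsPropagation (rec_two_rates_le)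

/-! ## §1 The two-rate invariant below a ceiling -/

/-- **TWO RATES, HYPOTHESES ONLY BELOW `k`**: `E_0 ≤ 0`, `E_{l+1} ≤ q·E_l + s_l` and `s_l ≤ c₁ρ₁ˡ + c₂ρ₂ˡ` for `l < k`, `0 ≤ q < ρ_i`, `0 ≤ c_i` ⇒ `E_l ≤ (c₁∕(ρ₁−q))ρ₁ˡ + (c₂∕(ρ₂−q))ρ₂ˡ`
for `l ≤ k`. [cite: Balaban1985Averaging, (97) p.32, (163) p.42] -/
theorem rec_two_rates_le_upto {q ρ₁ ρ₂ c₁ c₂ : ℝ} (hq : 0 ≤ q) (hρ₁ : q < ρ₁) (hρ₂ : q < ρ₂) (hc₁ : 0 ≤ c₁) (hc₂ : 0 ≤ c₂) (k : ℕ)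
    (E s : ℕ → ℝ) (h0 : E 0 ≤ 0) (hstep : ∀ l, l < k → E (l + 1) ≤ q * E l + s l) (hs : ∀ l, l < k → s l ≤ c₁ * ρ₁ ^ l + c₂ * ρ₂ ^ l) :
    ∀ l, l ≤ k → E l ≤ c₁ / (ρ₁ - q) * ρ₁ ^ l + c₂ / (ρ₂ - q) * ρ₂ ^ l := by
  -- truncate the sources above the ceiling by their bound and run the global invariant on the truncated recursion
  classical
  set E' : ℕ → ℝ := fun l => if l ≤ k then E l else c₁ / (ρ₁ - q) * ρ₁ ^ l + c₂ / (ρ₂ - q) * ρ₂ ^ l with hE'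
  set s' : ℕ → ℝ := fun l => if l < k then s l else c₁ * ρ₁ ^ l + c₂ * ρ₂ ^ l with hs'
  have hρ₁0 : 0 < ρ₁ - q := by linarith
  have hρ₂0 : 0 < ρ₂ - q := by linarith
  have key₁ : ∀ l : ℕ, q * (c₁ / (ρ₁ - q) * ρ₁ ^ l) + c₁ * ρ₁ ^ l = c₁ / (ρ₁ - q) * ρ₁ ^ (l + 1) := by
    intro l; rw [pow_succ]; field_simp; ring
  have key₂ : ∀ l : ℕ, q * (c₂ / (ρ₂ - q) * ρ₂ ^ l) + c₂ * ρ₂ ^ l = c₂ / (ρ₂ - q) * ρ₂ ^ (l + 1) := by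
    intro l; rw [pow_succ]; field_simp; ring
  -- the global invariant for the ORIGINAL recursion up to `k` is proved by induction directly
  intro l hl
  induction l with
  | zero =>
    have h1 : 0 ≤ c₁ / (ρ₁ - q) := div_nonneg hc₁ hρ₁0.le
    have h2 : 0 ≤ c₂ / (ρ₂ - q) := div_nonneg hc₂ hρ₂0.le
    simp only [pow_zero, mul_one]
    linarith
  | succ l ih =>
    have hlk : l < k := Nat.lt_of_succ_le hl
    have ih' := ih hlk.le
    calc E (l + 1) ≤ q * E l + s l := hstep l hlk
      _ ≤ q * (c₁ / (ρ₁ - q) * ρ₁ ^ l + c₂ / (ρ₂ - q) * ρ₂ ^ l) + (c₁ * ρ₁ ^ l + c₂ * ρ₂ ^ l) := by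
          have := mul_le_mul_of_nonneg_left ih' hq; linarith [hs l hlk]
      _ = c₁ / (ρ₁ - q) * ρ₁ ^ (l + 1) + c₂ / (ρ₂ - q) * ρ₂ ^ (l + 1) := by rw [← key₁, ← key₂]; ring

/-! ## §2 The power dictionary and the termwise dominations -/

/-- `L^{3l}·(Lᵏ)⁻⁴ ≤ (Lˡ)⁻¹` for `l ≤ k`, `L ≥ 1`. [cite: Balaban1985Averaging, (163) p.42] -/
theorem pow_three_mul_inv_pow_four_le {L : ℝ} (hL : 1 ≤ L) {l k : ℕ} (hl : l ≤ k) : L ^ (3 * l) * ((L ^ k) ^ 4)⁻¹ ≤ (L ^ l)⁻¹ := by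
  have hL0 : 0 < L := by linarith
  have hLl : 0 < L ^ l := pow_pos hL0 l
  have hLk4 : 0 < (L ^ k) ^ 4 := pow_pos (pow_pos hL0 k) 4
  rw [mul_inv_le_iff₀ hLk4, ← div_eq_inv_mul, le_div_iff₀ hLl]
  calc L ^ (3 * l) * L ^ l = (L ^ l) ^ 4 := by rw [← pow_add, ← pow_mul]; congr 1; ring
    _ ≤ (L ^ k) ^ 4 := pow_le_pow_left₀ hLl.le (pow_le_pow_right₀ hL hl) 4

/-- `(Lˡ)⁴·(Lᵏ)⁻⁴ ≤ 1` for `l ≤ k`, `L ≥ 1`. [cite: Balaban1985Averaging, (163) p.42] -/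
theorem pow_four_mul_inv_pow_four_le_one {L : ℝ} (hL : 1 ≤ L) {l k : ℕ} (hl : l ≤ k) : (L ^ l) ^ 4 * ((L ^ k) ^ 4)⁻¹ ≤ 1 := by
  have hL0 : 0 < L := by linarith
  rw [mul_inv_le_iff₀ (pow_pos (pow_pos hL0 k) 4), one_mul]
  exact pow_le_pow_left₀ (pow_pos hL0 l).le (pow_le_pow_right₀ hL hl) 4

/-- `(Lˡ)⁴(Lᵏ)⁻⁴·(Lˡ)⁻¹ = (Lᵏ)⁻⁴·(L³)ˡ` (`L ≠ 0`). [cite: Balaban1985Averaging, (163) p.42] -/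
theorem pow_four_mul_inv_mul_inv_eq {L : ℝ} (hL : L ≠ 0) (l k : ℕ) : (L ^ l) ^ 4 * ((L ^ k) ^ 4)⁻¹ * (L ^ l)⁻¹ = ((L ^ k) ^ 4)⁻¹ * (L ^ 3) ^ l := by
  have hLl : L ^ l ≠ 0 := pow_ne_zero l hL
  have h3 : (L ^ 3) ^ l = (L ^ l) ^ 3 := by rw [← pow_mul, ← pow_mul, mul_comm]
  rw [h3]
  calc (L ^ l) ^ 4 * ((L ^ k) ^ 4)⁻¹ * (L ^ l)⁻¹ = (L ^ l) ^ 3 * ((L ^ k) ^ 4)⁻¹ * (L ^ l * (L ^ l)⁻¹) := by ring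
    _ = _ := by rw [mul_inv_cancel₀ hLl, mul_one, mul_comm]

/-- the curvature square: `0 ≤ a ≤ 4e·(Lˡ(Lᵏ)⁻¹)²` ⇒ `a² ≤ 16e²·(Lˡ)⁴(Lᵏ)⁻⁴`. [cite: Balaban1985Averaging, (52)–(54) p.26] -/
theorem curvature_sq_le {L a e : ℝ} {l k : ℕ} (ha0 : 0 ≤ a) (ha : a ≤ 4 * e * (L ^ l * (L ^ k)⁻¹) ^ 2) :
    a ^ 2 ≤ 16 * e ^ 2 * ((L ^ l) ^ 4 * ((L ^ k) ^ 4)⁻¹) := by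
  have h' : a ^ 2 ≤ (4 * e * (L ^ l * (L ^ k)⁻¹) ^ 2) ^ 2 := pow_le_pow_left₀ ha0 ha 2
  refine h'.trans (le_of_eq ?_)
  rw [← inv_pow]; ring

/-- **THE LEGS-MASS BOUND**: `M_0 ≤ 0`, `M_{l+1} ≤ 2L⁻³M_l + bN·N_l` and the mass row for `l < k` ⇒ `M_l ≤ m₁·SA·(L⁻¹)ˡ + m₂·GA·Lˡ` (`l ≤ k`) with
`m₁ = bN(CN + CN″)∕(L⁻¹ − 2L⁻³)`, `m₂ = bN·CN′∕(L − 2L⁻³)` (`L ≥ 3`, `0 ≤ e ≤ 1`). [cite: Balaban1985Averaging, (97) p.32, (163) p.42] -/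
theorem legsMass_le {L : ℝ} (hL : 3 ≤ L) {bN CN CN' CN'' : ℝ} (hbN : 0 ≤ bN) (hCN : 0 ≤ CN) (hCN' : 0 ≤ CN') (hCN'' : 0 ≤ CN'') (k : ℕ) {e GA SA : ℝ}
    (he0 : 0 ≤ e) (he1 : e ≤ 1) (hGA : 0 ≤ GA) (hSA : 0 ≤ SA) (M N : ℕ → ℝ) (hM0 : M 0 ≤ 0)
    (hN : ∀ l, l < k → N l ≤ CN * (L ^ l)⁻¹ * SA + CN' * L ^ l * GA + CN'' * e ^ 2 * L ^ (3 * l) * ((L ^ k) ^ 4)⁻¹ * SA)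
    (hM : ∀ l, l < k → M (l + 1) ≤ 2 * (L ^ 3)⁻¹ * M l + bN * N l) :
    ∀ l, l ≤ k → M l ≤ bN * (CN + CN'') / (L⁻¹ - 2 * (L ^ 3)⁻¹) * SA * L⁻¹ ^ l + bN * CN' / (L - 2 * (L ^ 3)⁻¹) * GA * L ^ l := by
  have hL0 : 0 < L := by linarith
  have hL1 : 1 ≤ L := by linarith
  have hqM0 : 0 ≤ 2 * (L ^ 3)⁻¹ := by positivity
  have hgapM1 : 2 * (L ^ 3)⁻¹ < L⁻¹ := by
    rw [show L ^ 3 = L * L * L by ring, mul_inv, mul_inv]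
    have hLi : 0 < L⁻¹ := inv_pos.2 hL0
    have hLi1 : L⁻¹ ≤ 1 / 3 := by rw [inv_eq_one_div]; exact one_div_le_one_div_of_le (by norm_num) hL
    nlinarith [mul_pos hLi hLi, mul_pos (mul_pos hLi hLi) hLi]
  have hgapM2 : 2 * (L ^ 3)⁻¹ < L := lt_of_lt_of_le (hgapM1.trans_le (inv_le_one_of_one_le₀ hL1)) hL1
  have he21 : e ^ 2 ≤ 1 := by nlinarith
  have h := rec_two_rates_le_upto hqM0 hgapM1 hgapM2 (show 0 ≤ bN * (CN + CN'') * SA by positivity) (show 0 ≤ bN * CN' * GA by positivity) k M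
    (fun l => bN * N l) hM0 hM ?_
  · intro l hl
    refine (h l hl).trans (le_of_eq ?_)
    ring
  · intro l hl
    have h1 := hN l hl
    have hd := pow_three_mul_inv_pow_four_le hL1 hl.le
    have h2 : CN'' * e ^ 2 * L ^ (3 * l) * ((L ^ k) ^ 4)⁻¹ * SA ≤ CN'' * (L ^ l)⁻¹ * SA := by
      have h0 : 0 ≤ CN'' * e ^ 2 := by positivity
      calc CN'' * e ^ 2 * L ^ (3 * l) * ((L ^ k) ^ 4)⁻¹ * SA = CN'' * e ^ 2 * (L ^ (3 * l) * ((L ^ k) ^ 4)⁻¹) * SA := by ring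
        _ ≤ CN'' * e ^ 2 * (L ^ l)⁻¹ * SA := mul_le_mul_of_nonneg_right (mul_le_mul_of_nonneg_left hd h0) hSA
        _ ≤ CN'' * 1 * (L ^ l)⁻¹ * SA := by gcongr
        _ = CN'' * (L ^ l)⁻¹ * SA := by ring
    have hinv : (L ^ l)⁻¹ = L⁻¹ ^ l := (inv_pow L l).symm
    calc bN * N l ≤ bN * (CN * (L ^ l)⁻¹ * SA + CN' * L ^ l * GA + CN'' * (L ^ l)⁻¹ * SA) := mul_le_mul_of_nonneg_left (by linarith) hbN
      _ = bN * (CN + CN'') * SA * L⁻¹ ^ l + bN * CN' * GA * L ^ l := by rw [← hinv]; ring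

/-- **THE LEGS SOURCES ARE DOMINATED BY THE TWO RATES `L, L³`**: with the legs-mass bound of `legsMass_le` (coefficients `m₁ m₂ ≥ 0`), the two rows and the curvature square, for `l < k`,
`pM·a_l²·M_l + aG·G_l + pN·a_l²·N_l ≤ α·Lˡ + β·(L³)ˡ` with `α = aG·CG·GA + 16e²(pM·m₂·GA + pN·CN′·GA)`, `β = e²(16pM·m₁ + aG·CG′ + 16pN·CN + 16e²pN·CN″)·SA·(Lᵏ)⁻⁴`.
[cite: Balaban1985Averaging, (97) p.32, (110)–(112) p.34, (163) p.42] -/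
theorem legsSource_le {L : ℝ} (hL : 1 ≤ L) {pM aG pN CG CG' CN CN' CN'' m1 m2 : ℝ} (hpM : 0 ≤ pM) (haG : 0 ≤ aG) (hpN : 0 ≤ pN)
    (hCN' : 0 ≤ CN') (hCN'' : 0 ≤ CN'') (hm2 : 0 ≤ m2) {k : ℕ} {e GA SA : ℝ} (hGA : 0 ≤ GA) (hSA : 0 ≤ SA)
    (M G N a : ℕ → ℝ) (hMnn : ∀ l, 0 ≤ M l) (hNnn : ∀ l, 0 ≤ N l) (hann : ∀ l, 0 ≤ a l)
    (ha : ∀ l, l < k → a l ≤ 4 * e * (L ^ l * (L ^ k)⁻¹) ^ 2)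
    (hG : ∀ l, l < k → G l ≤ CG * L ^ l * GA + CG' * e ^ 2 * L ^ (3 * l) * ((L ^ k) ^ 4)⁻¹ * SA)
    (hN : ∀ l, l < k → N l ≤ CN * (L ^ l)⁻¹ * SA + CN' * L ^ l * GA + CN'' * e ^ 2 * L ^ (3 * l) * ((L ^ k) ^ 4)⁻¹ * SA)
    (hMb : ∀ l, l ≤ k → M l ≤ m1 * SA * L⁻¹ ^ l + m2 * GA * L ^ l) :
    ∀ l, l < k → pM * a l ^ 2 * M l + aG * G l + pN * a l ^ 2 * N l
      ≤ (aG * CG * GA + 16 * e ^ 2 * (pM * m2 * GA + pN * CN' * GA)) * L ^ l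
        + e ^ 2 * (16 * pM * m1 + aG * CG' + 16 * pN * CN + 16 * e ^ 2 * pN * CN'') * SA * ((L ^ k) ^ 4)⁻¹ * (L ^ 3) ^ l := by
  intro l hl
  have hL0 : 0 < L := by linarith
  have hLl : 0 < L ^ l := pow_pos hL0 l
  have hLk4i : 0 ≤ ((L ^ k) ^ 4)⁻¹ := by positivity
  have hpow3 : L ^ (3 * l) = (L ^ 3) ^ l := pow_mul L 3 l
  have hinv : (L ^ l)⁻¹ = L⁻¹ ^ l := (inv_pow L l).symm
  set A4 : ℝ := (L ^ l) ^ 4 * ((L ^ k) ^ 4)⁻¹ with hA4d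
  have hA41 : A4 ≤ 1 := pow_four_mul_inv_pow_four_le_one hL hl.le
  have hA40 : 0 ≤ A4 := by positivity
  have ha2 : a l ^ 2 ≤ 16 * e ^ 2 * A4 := curvature_sq_le (hann l) (ha l hl)
  have e1 : A4 * (L ^ l)⁻¹ = ((L ^ k) ^ 4)⁻¹ * (L ^ 3) ^ l := pow_four_mul_inv_mul_inv_eq hL0.ne' l k
  have e2 : A4 * L ^ l ≤ L ^ l := mul_le_of_le_one_left hLl.le hA41
  -- (i) the mass slot
  have hi : pM * a l ^ 2 * M l ≤ 16 * e ^ 2 * (pM * m2 * GA) * L ^ l + e ^ 2 * (16 * pM * m1) * SA * ((L ^ k) ^ 4)⁻¹ * (L ^ 3) ^ l := by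
    have h1 : pM * a l ^ 2 * M l ≤ pM * (16 * e ^ 2 * A4) * (m1 * SA * L⁻¹ ^ l + m2 * GA * L ^ l) :=
      (mul_le_mul_of_nonneg_right (mul_le_mul_of_nonneg_left ha2 hpM) (hMnn l)).trans (mul_le_mul_of_nonneg_left (hMb l hl.le) (by positivity))
    refine h1.trans ?_
    have t1 : pM * (16 * e ^ 2 * A4) * (m1 * SA * L⁻¹ ^ l) = e ^ 2 * (16 * pM * m1) * SA * ((L ^ k) ^ 4)⁻¹ * (L ^ 3) ^ l := by
      rw [← hinv]
      calc pM * (16 * e ^ 2 * A4) * (m1 * SA * (L ^ l)⁻¹) = e ^ 2 * (16 * pM * m1) * SA * (A4 * (L ^ l)⁻¹) := by ring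
        _ = _ := by rw [e1]; ring
    have t2 : pM * (16 * e ^ 2 * A4) * (m2 * GA * L ^ l) ≤ 16 * e ^ 2 * (pM * m2 * GA) * L ^ l := by
      calc pM * (16 * e ^ 2 * A4) * (m2 * GA * L ^ l) = 16 * e ^ 2 * (pM * m2 * GA) * (A4 * L ^ l) := by ring
        _ ≤ _ := mul_le_mul_of_nonneg_left e2 (by positivity)
    rw [mul_add]; linarith
  -- (ii) the gradient slot
  have hii : aG * G l ≤ aG * CG * GA * L ^ l + e ^ 2 * (aG * CG') * SA * ((L ^ k) ^ 4)⁻¹ * (L ^ 3) ^ l := by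
    refine (mul_le_mul_of_nonneg_left (hG l hl) haG).trans (le_of_eq ?_)
    rw [hpow3]; ring
  -- (iii) the tower-mass slot
  have hiii : pN * a l ^ 2 * N l
      ≤ 16 * e ^ 2 * (pN * CN' * GA) * L ^ l + e ^ 2 * (16 * pN * CN + 16 * e ^ 2 * pN * CN'') * SA * ((L ^ k) ^ 4)⁻¹ * (L ^ 3) ^ l := by
    have h1 : pN * a l ^ 2 * N l ≤ pN * (16 * e ^ 2 * A4) * (CN * (L ^ l)⁻¹ * SA + CN' * L ^ l * GA + CN'' * e ^ 2 * L ^ (3 * l) * ((L ^ k) ^ 4)⁻¹ * SA) :=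
      (mul_le_mul_of_nonneg_right (mul_le_mul_of_nonneg_left ha2 hpN) (hNnn l)).trans (mul_le_mul_of_nonneg_left (hN l hl) (by positivity))
    refine h1.trans ?_
    have e3 : A4 * ((L ^ 3) ^ l * ((L ^ k) ^ 4)⁻¹) ≤ (L ^ 3) ^ l * ((L ^ k) ^ 4)⁻¹ := mul_le_of_le_one_left (by positivity) hA41
    have t1 : pN * (16 * e ^ 2 * A4) * (CN * (L ^ l)⁻¹ * SA) = e ^ 2 * (16 * pN * CN) * SA * ((L ^ k) ^ 4)⁻¹ * (L ^ 3) ^ l := by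
      calc pN * (16 * e ^ 2 * A4) * (CN * (L ^ l)⁻¹ * SA) = e ^ 2 * (16 * pN * CN) * SA * (A4 * (L ^ l)⁻¹) := by ring
        _ = _ := by rw [e1]; ring
    have t2 : pN * (16 * e ^ 2 * A4) * (CN' * L ^ l * GA) ≤ 16 * e ^ 2 * (pN * CN' * GA) * L ^ l := by
      calc pN * (16 * e ^ 2 * A4) * (CN' * L ^ l * GA) = 16 * e ^ 2 * (pN * CN' * GA) * (A4 * L ^ l) := by ring
        _ ≤ _ := mul_le_mul_of_nonneg_left e2 (by positivity)
    have t3 : pN * (16 * e ^ 2 * A4) * (CN'' * e ^ 2 * L ^ (3 * l) * ((L ^ k) ^ 4)⁻¹ * SA) ≤ e ^ 2 * (16 * e ^ 2 * pN * CN'') * SA * ((L ^ k) ^ 4)⁻¹ * (L ^ 3) ^ l := by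
      rw [hpow3]
      calc pN * (16 * e ^ 2 * A4) * (CN'' * e ^ 2 * (L ^ 3) ^ l * ((L ^ k) ^ 4)⁻¹ * SA)
          = e ^ 2 * (16 * e ^ 2 * pN * CN'') * SA * (A4 * ((L ^ 3) ^ l * ((L ^ k) ^ 4)⁻¹)) := by ring
        _ ≤ e ^ 2 * (16 * e ^ 2 * pN * CN'') * SA * ((L ^ 3) ^ l * ((L ^ k) ^ 4)⁻¹) := mul_le_mul_of_nonneg_left e3 (by positivity)
        _ = _ := by ring
    rw [mul_add, mul_add]; linarith
  linarith

/-! ## §3 ★★★ The scalar knit -/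

/-- ★★★ **(K2-S) THE SCALAR KNIT OF (R-LEGS-cov)**: for `L ≥ 3` and nonnegative structure constants `pM aG pN bN CG CG′ CN CN′ CN″` there are `Cr, Cr′ ≥ 0` (functions of these only) such that
for every ceiling `k`, every `0 < e ≤ 1`, `GA, SA ≥ 0` and all sequences `E M G N a` with `E_0 ≤ 0`, `M_0 ≤ 0`, `M, N ≥ 0`, `0 ≤ a_l ≤ 4e(Lˡ(Lᵏ)⁻¹)²` (`l < k`), the two rows and the two
one-step recursions below `k`, one has `E_k ≤ Cr·Lᵏ·GA + Cr′·e·(Lᵏ)⁻¹·SA`. [cite: Balaban1985Averaging, (97) p.32, (110)–(112) p.34, (160)–(163) p.42] -/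
theorem scalar_legs_knit {L : ℝ} (hL : 3 ≤ L) {pM aG pN bN CG CG' CN CN' CN'' : ℝ} (hpM : 0 ≤ pM) (haG : 0 ≤ aG) (hpN : 0 ≤ pN) (hbN : 0 ≤ bN)
    (hCG : 0 ≤ CG) (hCG' : 0 ≤ CG') (hCN : 0 ≤ CN) (hCN' : 0 ≤ CN') (hCN'' : 0 ≤ CN'') :
    ∃ Cr Cr' : ℝ, 0 ≤ Cr ∧ 0 ≤ Cr' ∧
      ∀ (k : ℕ) (e GA SA : ℝ), 0 < e → e ≤ 1 → 0 ≤ GA → 0 ≤ SA →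
      ∀ (E M G N a : ℕ → ℝ), E 0 ≤ 0 → M 0 ≤ 0 → (∀ l, 0 ≤ M l) → (∀ l, 0 ≤ N l) → (∀ l, 0 ≤ a l) →
        (∀ l, l < k → a l ≤ 4 * e * (L ^ l * (L ^ k)⁻¹) ^ 2) →
        (∀ l, l < k → G l ≤ CG * L ^ l * GA + CG' * e ^ 2 * L ^ (3 * l) * ((L ^ k) ^ 4)⁻¹ * SA) →
        (∀ l, l < k → N l ≤ CN * (L ^ l)⁻¹ * SA + CN' * L ^ l * GA + CN'' * e ^ 2 * L ^ (3 * l) * ((L ^ k) ^ 4)⁻¹ * SA) →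
        (∀ l, l < k → M (l + 1) ≤ 2 * (L ^ 3)⁻¹ * M l + bN * N l) →
        (∀ l, l < k → E (l + 1) ≤ 4 * L⁻¹ * E l + pM * a l ^ 2 * M l + aG * G l + pN * a l ^ 2 * N l) →
        E k ≤ Cr * L ^ k * GA + Cr' * e * (L ^ k)⁻¹ * SA := by
  have hL0 : 0 < L := by linarith
  have hL1 : 1 ≤ L := by linarith
  have hq0 : 0 ≤ 4 * L⁻¹ := by positivity
  have hgapE1 : 4 * L⁻¹ < L := by
    have h1 : 4 * L⁻¹ ≤ 4 / 3 := by
      rw [← div_eq_mul_inv]; exact div_le_div_of_nonneg_left (by norm_num) (by norm_num) hL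
    linarith
  have hgapE2 : 4 * L⁻¹ < L ^ 3 := by
    refine hgapE1.trans_le ?_
    calc L = L ^ 1 := (pow_one L).symm
      _ ≤ L ^ 3 := pow_le_pow_right₀ hL1 (by norm_num)
  have hgapM1 : 0 < L⁻¹ - 2 * (L ^ 3)⁻¹ := by
    rw [show L ^ 3 = L * L * L by ring, mul_inv, mul_inv]
    have hLi : 0 < L⁻¹ := inv_pos.2 hL0
    have hLi1 : L⁻¹ ≤ 1 / 3 := by rw [inv_eq_one_div]; exact one_div_le_one_div_of_le (by norm_num) hL
    nlinarith [mul_pos hLi hLi, mul_pos (mul_pos hLi hLi) hLi]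
  have hgapM2 : 0 < L - 2 * (L ^ 3)⁻¹ := by
    have : L⁻¹ ≤ L := (inv_le_one_of_one_le₀ hL1).trans hL1
    linarith
  -- the constants
  set m1 : ℝ := bN * (CN + CN'') / (L⁻¹ - 2 * (L ^ 3)⁻¹) with hm1
  set m2 : ℝ := bN * CN' / (L - 2 * (L ^ 3)⁻¹) with hm2
  have hm10 : 0 ≤ m1 := div_nonneg (by positivity) hgapM1.le
  have hm20 : 0 ≤ m2 := div_nonneg (by positivity) hgapM2.le
  refine ⟨(aG * CG + 16 * (pM * m2 + pN * CN')) / (L - 4 * L⁻¹), (16 * pM * m1 + aG * CG' + 16 * pN * CN + 16 * pN * CN'') / (L ^ 3 - 4 * L⁻¹),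
    div_nonneg (by positivity) (by linarith), div_nonneg (by positivity) (by linarith), ?_⟩
  intro k e GA SA he he1 hGA hSA E M G N a hE0 hM0 hMnn hNnn hann ha hG hN hM hE
  have he0 : 0 ≤ e := he.le
  have he2 : e ^ 2 ≤ e := by nlinarith
  have he21 : e ^ 2 ≤ 1 := he2.trans he1
  have hLk : 0 < L ^ k := pow_pos hL0 k
  -- (1) the legs-mass
  have hMb : ∀ l, l ≤ k → M l ≤ m1 * SA * L⁻¹ ^ l + m2 * GA * L ^ l :=
    legsMass_le hL hbN hCN hCN' hCN'' k he0 he1 hGA hSA M N hM0 hN hM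
  -- (2) the sources
  set α : ℝ := aG * CG * GA + 16 * e ^ 2 * (pM * m2 * GA + pN * CN' * GA) with hα
  set β : ℝ := e ^ 2 * (16 * pM * m1 + aG * CG' + 16 * pN * CN + 16 * e ^ 2 * pN * CN'') * SA * ((L ^ k) ^ 4)⁻¹ with hβ
  have hα0 : 0 ≤ α := by positivity
  have hβ0 : 0 ≤ β := by positivity
  have hsrc : ∀ l, l < k → pM * a l ^ 2 * M l + aG * G l + pN * a l ^ 2 * N l ≤ α * L ^ l + β * (L ^ 3) ^ l :=
    legsSource_le hL1 hpM haG hpN hCN' hCN'' hm20 hGA hSA M G N a hMnn hNnn hann ha hG hN hMb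
  -- (3) propagate the legs
  have hEk := rec_two_rates_le_upto hq0 hgapE1 hgapE2 hα0 hβ0 k E (fun l => pM * a l ^ 2 * M l + aG * G l + pN * a l ^ 2 * N l) hE0
    (fun l hl => by have := hE l hl; linarith) hsrc k le_rfl
  refine hEk.trans ?_
  -- (4) read the two slots at the top
  have hgap1 : 0 < L - 4 * L⁻¹ := by linarith
  have hgap2 : 0 < L ^ 3 - 4 * L⁻¹ := by linarith
  have hαle : α ≤ (aG * CG + 16 * (pM * m2 + pN * CN')) * GA := by
    have : e ^ 2 * ((pM * m2 + pN * CN') * GA) ≤ 1 * ((pM * m2 + pN * CN') * GA) := mul_le_mul_of_nonneg_right he21 (by positivity)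
    rw [hα]; linarith
  have hβle : β * (L ^ 3) ^ k ≤ (16 * pM * m1 + aG * CG' + 16 * pN * CN + 16 * pN * CN'') * e * (L ^ k)⁻¹ * SA := by
    have hk3 : ((L ^ k) ^ 4)⁻¹ * (L ^ 3) ^ k = (L ^ k)⁻¹ := by
      have hne : L ^ k ≠ 0 := hLk.ne'
      have h3 : (L ^ 3) ^ k = (L ^ k) ^ 3 := by rw [← pow_mul, ← pow_mul, mul_comm]
      rw [h3]
      calc ((L ^ k) ^ 4)⁻¹ * (L ^ k) ^ 3 = ((L ^ k) ^ 3 * L ^ k)⁻¹ * (L ^ k) ^ 3 := by rw [← pow_succ]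
        _ = (L ^ k)⁻¹ * (((L ^ k) ^ 3)⁻¹ * (L ^ k) ^ 3) := by rw [mul_inv_rev]; ring
        _ = (L ^ k)⁻¹ := by rw [inv_mul_cancel₀ (pow_ne_zero 3 hne), mul_one]
    have h1 : e ^ 2 * (16 * pM * m1 + aG * CG' + 16 * pN * CN + 16 * e ^ 2 * pN * CN'') ≤ (16 * pM * m1 + aG * CG' + 16 * pN * CN + 16 * pN * CN'') * e := by
      have s1 : 16 * pM * m1 + aG * CG' + 16 * pN * CN + 16 * e ^ 2 * pN * CN'' ≤ 16 * pM * m1 + aG * CG' + 16 * pN * CN + 16 * pN * CN'' := by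
        have : e ^ 2 * (pN * CN'') ≤ 1 * (pN * CN'') := mul_le_mul_of_nonneg_right he21 (by positivity)
        linarith
      have s0 : 0 ≤ 16 * pM * m1 + aG * CG' + 16 * pN * CN + 16 * e ^ 2 * pN * CN'' := by positivity
      calc e ^ 2 * (16 * pM * m1 + aG * CG' + 16 * pN * CN + 16 * e ^ 2 * pN * CN'')
          ≤ e * (16 * pM * m1 + aG * CG' + 16 * pN * CN + 16 * e ^ 2 * pN * CN'') := mul_le_mul_of_nonneg_right he2 s0
        _ ≤ e * (16 * pM * m1 + aG * CG' + 16 * pN * CN + 16 * pN * CN'') := mul_le_mul_of_nonneg_left s1 he0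
        _ = _ := by ring
    calc β * (L ^ 3) ^ k = e ^ 2 * (16 * pM * m1 + aG * CG' + 16 * pN * CN + 16 * e ^ 2 * pN * CN'') * SA * (((L ^ k) ^ 4)⁻¹ * (L ^ 3) ^ k) := by
          rw [hβ]; ring
      _ ≤ (16 * pM * m1 + aG * CG' + 16 * pN * CN + 16 * pN * CN'') * e * SA * (((L ^ k) ^ 4)⁻¹ * (L ^ 3) ^ k) :=
          mul_le_mul_of_nonneg_right (mul_le_mul_of_nonneg_right h1 hSA) (by positivity)
      _ = _ := by rw [hk3]; ring
  calc α / (L - 4 * L⁻¹) * L ^ k + β / (L ^ 3 - 4 * L⁻¹) * (L ^ 3) ^ k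
      = α * L ^ k / (L - 4 * L⁻¹) + β * (L ^ 3) ^ k / (L ^ 3 - 4 * L⁻¹) := by ring
    _ ≤ (aG * CG + 16 * (pM * m2 + pN * CN')) * GA * L ^ k / (L - 4 * L⁻¹)
        + (16 * pM * m1 + aG * CG' + 16 * pN * CN + 16 * pN * CN'') * e * (L ^ k)⁻¹ * SA / (L ^ 3 - 4 * L⁻¹) := by
        gcongr
    _ = _ := by ring

end Summit.QuantumFields.YangMills.Theorems.Prop7RLegsCovScalar

end
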